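import Summits.CriticalPhenomena.SAWScalingLimit.Theorems.SAWLoopFugacityFlowSimpleSubseqLimitsTransferLattice
import Summits.CriticalPhenomena.SAWScalingLimit.Theorems.SAWLoopFugacityFlowSimpleSubseqLimitsEndpoints
import Summits.CriticalPhenomena.SAWScalingLimit.Theorems.SAWLoopFugacityFlowSimpleSubseqLimitsPSLine
import Mathlib.MeasureTheory.Measure.RegularityCompacts
import HarnessLib

/-!
# Line `slit-continuous-restriction` — the soft transfer, part 4: the registered stub
# `stub_transferCore` (crux stmt-CriticalPhenomena-4982, decl
# `Summit.CriticalPhenomena.SAWScalingLimit.Theses.SAWLoopFugacityFlow.SimpleSubseqLimits`;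
# registered skeleton `Cruxes/SimpleSubseqLimits/Lines/slit_continuous_restriction.lean`)

THE SOFT TRANSFER (lead c9): `LatticeBound → PrefixTiming → PastsCompact → SubArc →
SequentialSlitAvoidance → AvoidanceValues → FarReturnNullOffTarget`.

Fix a subsequential limit `ν` along `s n → 0⁺`, a ball `B̄(q, r)` and `η > 0`; we show that the
off-target far-return event `E` at `(q, r, η)` is `ν`-null. Radii: entrance ball `ρ = 3r/2`, depth
`ρ₀ = 5r/4`, intermediate `ρ₁ = 9r/8`, guard `R = 4r`, cover guard `R' = 3r`.
1. (`locallyUniform_of_sequential`, part 1) the input is locally uniform.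
2. Good classes (`source = a`, `target = b`, `range ⊆ cl D`, SHAPE from `rangeArc_of_avoidanceValues`)
   fill a measurable set `M` of full measure; if `dist a q ≤ 5r` then `E ∩ M = ∅` (guard at `u = 0`).
3. Otherwise fix `α > 0`: Ulam tightness (`MeasurableSet.exists_isCompact_sdiff_lt` on the Polish
   `CurveClass ℂ`) gives a compact `K ⊆ M` with `ν (M ∖ K) < α/2`.
4. The constrained past set `P = pastSet K q b ρ ρ₁ η 0` is compact (`PastsCompact`) and consists of
   ADMISSIBLE pasts (`SubArc`); the locally uniform bound at `θ = α/2` gives, for each `p ∈ P`, a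
   width `ε_p`, a radius `ζ_p ≤ min (ε_p/4) (r/2)` and a mesh threshold; a finite subcover by the
   balls `B(p, ζ_p)` (`exists_cover`) defines the open set `N'' = ⋃ B(p, ζ_p)`, which contains a
   `κ`-relaxed past set (`PastsCompact`).
5. `E ∩ K ⊆ mk '' Conf` (`conf_of_return`, part 2) with `Conf` OPEN (`isOpen_setOf_conf`), so the
   open-set portmanteau bound `Passage.measure_image_mk_le_limsup_law` applies.
6. On the lattice, for small meshes, `{Conf ∘ latticeCurve}` is inside the event of `LatticeBound`
   with the ASSIGNMENT of each good prefix to ONE cover element (`law_conf_le`: `latticeEvent_of_conf`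
   of part 3 + far-past stability of part 1), so its law is `≤ α/2`.
7. Hence `ν E ≤ ν (E ∩ K) + ν (M ∖ K) + ν Mᶜ ≤ α/2 + α/2 + 0`; `α → 0`.
-/

noncomputable section

open MeasureTheory Filter Topology Set Metric Function
open Literature.Probability.RandomPlanarGeometry Literature.Probability.RandomPlanarGeometry.SAW
open Literature.Probability.LatticeModels
open scoped ENNReal NNReal BoundedContinuousFunction unitInterval

namespace Summit.CriticalPhenomena.SAWScalingLimit.Theorems.SimpleSubseqLimits.SlitRestriction.Transfer

open Summit.CriticalPhenomena.SAWScalingLimit.Theorems.SimpleSubseqLimits.Negative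
  (ae_source_target_range_of_weakLimitAlong)
open Summit.CriticalPhenomena.SAWScalingLimit.Theorems.SimpleSubseqLimits.MarkedPointRevisit.Passage
  (IsSubseqLimit latticeCurve measure_image_mk_le_limsup_law)
open Summit.CriticalPhenomena.SAWScalingLimit.Theorems.SimpleSubseqLimits.PastShadowing.Main
  (AvoidanceValues rangeArc_of_avoidanceValues)
open Summit.CriticalPhenomena.SAWScalingLimit.Theorems.SimpleSubseqLimits.SlitRestriction.Lattice
  (prefixEvent approachEvent LatticeBound)
open Summit.CriticalPhenomena.SAWScalingLimit.Theorems.SimpleSubseqLimits.SlitRestriction.Timing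
  (vertexTime PrefixTiming)
open Summit.CriticalPhenomena.SAWScalingLimit.Theorems.SimpleSubseqLimits.SlitRestriction.Pasts
  (truncate pastSet PastsCompact)
open Summit.CriticalPhenomena.SAWScalingLimit.Theorems.SimpleSubseqLimits.SlitRestriction.Arc
  (IsAdmissiblePast SubArc)
open Summit.CriticalPhenomena.SAWScalingLimit.Theorems.SimpleSubseqLimits.SlitRestriction.Endpoints
  (OffTargetFarReturn offTargetFarReturnEvent FarReturnNullOffTarget)

/-! ## The finite cover of the admissible pasts -/

/-- **Cover of a compact set of admissible pasts.** Under locally uniform slit avoidance, a compact set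
`P` of classes with admissible representatives at `B̄(q, ρ)` is covered by finitely many balls
`B(p, ζ_p)`, `p ∈ t ⊆ P`, each carrying a representative `π_p`, a width `ε_p > 0`, a radius
`0 < ζ_p ≤ min (ε_p/4) ζmax` and a mesh threshold `δ_p > 0` such that every first-entrance prefix of
mesh `< δ_p` whose class lies in `B(p, ζ_p)` obeys the conditional bound with `(far_{R'} π_p, ε_p)`.
[folklore] -/
theorem exists_cover (hU : LocallyUniformSlitAvoidance) {D : DobrushinDomain} {a b : ℝ → Site 2}
    (hab : SAW.IsEndpointApprox D a b) {q : ℂ} {ρ R' : ℝ} (hρ : 0 < ρ) (hρR : ρ < R') {θ : ℝ}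
    (hθ : 0 < θ) {ζmax : ℝ} (hζmax : 0 < ζmax) {P : Set (CurveClass ℂ)} (hP : IsCompact P)
    (hadm : ∀ p ∈ P, ∃ π : Curve ℂ, CurveClass.mk π = p ∧ IsAdmissiblePast D π q ρ) :
    ∃ (t : Finset (CurveClass ℂ)) (πr : CurveClass ℂ → Curve ℂ) (εr ζr δr : CurveClass ℂ → ℝ),
      (∀ p ∈ t, CurveClass.mk (πr p) = p ∧ 0 < εr p ∧ 0 < ζr p ∧ ζr p ≤ εr p / 4 ∧ ζr p ≤ ζmax ∧
        0 < δr p ∧ ∀ δ : ℝ, 0 < δ → δ < δr p → ∀ (t₀ : Site 2) (ω : SAW.DomainSAW D.carrier δ (a δ) t₀),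
          meshPoint δ t₀ ∈ closedBall q ρ →
          (∀ x ∈ ω.walk.support.dropLast, meshPoint δ x ∉ closedBall q ρ) →
          ω.curve ∈ ball p (ζr p) →
          SAW.law D.carrier δ (a δ) (b δ) (approachEvent (v := b δ) ω (farPast (πr p) q R') (εr p)) ≤
            ENNReal.ofReal θ * SAW.law D.carrier δ (a δ) (b δ) (prefixEvent (v := b δ) ω)) ∧
      P ⊆ ⋃ p ∈ t, ball p (ζr p) := by
  have hall : ∀ p ∈ P, ∃ (π : Curve ℂ) (ε ζ δ₀ : ℝ), CurveClass.mk π = p ∧ 0 < ε ∧ 0 < ζ ∧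
      ζ ≤ ε / 4 ∧ ζ ≤ ζmax ∧ 0 < δ₀ ∧ ∀ δ : ℝ, 0 < δ → δ < δ₀ →
        ∀ (t₀ : Site 2) (ω : SAW.DomainSAW D.carrier δ (a δ) t₀),
          meshPoint δ t₀ ∈ closedBall q ρ →
          (∀ x ∈ ω.walk.support.dropLast, meshPoint δ x ∉ closedBall q ρ) →
          ω.curve ∈ ball p ζ →
          SAW.law D.carrier δ (a δ) (b δ) (approachEvent (v := b δ) ω (farPast π q R') ε) ≤
            ENNReal.ofReal θ * SAW.law D.carrier δ (a δ) (b δ) (prefixEvent (v := b δ) ω) := by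
    intro p hp
    obtain ⟨π, hπp, hadmπ⟩ := hadm p hp
    obtain ⟨ε, hε, N, hN, hπN, δ₀, hδ₀, hb⟩ := hU D a b hab π q ρ R' hρ hρR hadmπ θ hθ
    rw [hπp] at hπN
    obtain ⟨ξ, hξ, hball⟩ := Metric.isOpen_iff.1 hN p hπN
    refine ⟨π, ε, min ξ (min (ε / 4) ζmax), δ₀, hπp, hε, lt_min hξ (lt_min (by positivity) hζmax),
      (min_le_right _ _).trans (min_le_left _ _), (min_le_right _ _).trans (min_le_right _ _), hδ₀,
      fun δ hδ hδδ₀ t₀ ω htip hout hmem => hb δ hδ hδδ₀ t₀ ω htip hout ?_⟩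
    exact hball (ball_subset_ball (min_le_left _ _) hmem)
  haveI : Nonempty (Curve ℂ) := ⟨Curve.const 0⟩
  choose! πr εr ζr δr hspec using hall
  obtain ⟨t, htP, hcover⟩ := hP.elim_nhds_subcover (fun p => ball p (ζr p))
    fun p hp => ball_mem_nhds p (hspec p hp).2.2.1
  exact ⟨t, πr, εr, ζr, δr, fun p hp => hspec p (htP p hp), hcover⟩

/-- A finite family of positive reals has a positive lower bound. [folklore] -/
theorem exists_pos_forall_le (t : Finset (CurveClass ℂ)) (f : CurveClass ℂ → ℝ)
    (hf : ∀ p ∈ t, 0 < f p) : ∃ c : ℝ, 0 < c ∧ ∀ p ∈ t, c ≤ f p := by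
  rcases t.eq_empty_or_nonempty with rfl | hne
  · exact ⟨1, one_pos, fun p hp => absurd hp (Finset.notMem_empty p)⟩
  · obtain ⟨p₀, hp₀, hmin⟩ := t.exists_min_image f hne
    exact ⟨f p₀, hf p₀ hp₀, hmin⟩

/-! ## The lattice bound at a fixed mesh -/

/-- **Lattice bound for the squeeze configuration.** At a mesh `δ > 0` with `ρ₀ + δ ≤ ρ`, if every
cover element `p ∈ t` carries a representative `π_p`, guard margin `R' ≤ R - ζ_p`, width margin
`ε' + δ + ζ_p ≤ ε_p`, and the conditional bound for first-entrance prefixes with class in `B(p, ζ_p)`,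
then the law of `{Conf ∘ latticeCurve}` (with `N = ⋃ B(p, ζ_p)`) is at most `θ`: by
`latticeEvent_of_conf` and far-past stability the event lies in the event of `LatticeBound` for the
ASSIGNMENT of each good vertex list to one cover element containing its class. [folklore] -/
theorem law_conf_le (hLB : LatticeBound) {D : DobrushinDomain} {a b : ℝ → Site 2} {q : ℂ}
    {ρ ρ₀ R R' ε' θ δ : ℝ} (hθ : 0 ≤ θ) (hδ : 0 < δ) (hρ₀ : ρ₀ + δ ≤ ρ)
    (t : Finset (CurveClass ℂ)) (πr : CurveClass ℂ → Curve ℂ) (εr ζr : CurveClass ℂ → ℝ)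
    (hπ : ∀ p ∈ t, CurveClass.mk (πr p) = p) (hζR : ∀ p ∈ t, R' ≤ R - ζr p)
    (hε' : ∀ p ∈ t, ε' + δ + ζr p ≤ εr p)
    (hbound : ∀ p ∈ t, ∀ (t₀ : Site 2) (ω : SAW.DomainSAW D.carrier δ (a δ) t₀),
        meshPoint δ t₀ ∈ closedBall q ρ →
        (∀ x ∈ ω.walk.support.dropLast, meshPoint δ x ∉ closedBall q ρ) →
        ω.curve ∈ ball p (ζr p) →
        SAW.law D.carrier δ (a δ) (b δ) (approachEvent (v := b δ) ω (farPast (πr p) q R') (εr p)) ≤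
          ENNReal.ofReal θ * SAW.law D.carrier δ (a δ) (b δ) (prefixEvent (v := b δ) ω)) :
    SAW.law D.carrier δ (a δ) (b δ)
        {γ | Conf q ρ ρ₀ R ε' (⋃ p ∈ t, ball p (ζr p)) (latticeCurve γ)} ≤ ENNReal.ofReal θ := by
  classical
  -- the selection of ONE cover element for each vertex list whose class is covered
  have hsel : ∀ L : List (Site 2), ∃ p : CurveClass ℂ,
      (∃ p' ∈ t, CurveClass.mk (⟨polyline (L.map (meshPoint δ))⟩ : Curve ℂ) ∈ ball p' (ζr p')) →
        p ∈ t ∧ CurveClass.mk (⟨polyline (L.map (meshPoint δ))⟩ : Curve ℂ) ∈ ball p (ζr p) := by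
    intro L
    by_cases h : ∃ p' ∈ t, CurveClass.mk (⟨polyline (L.map (meshPoint δ))⟩ : Curve ℂ) ∈ ball p' (ζr p')
    · obtain ⟨p, hp, hm⟩ := h
      exact ⟨p, fun _ => ⟨hp, hm⟩⟩
    · exact ⟨CurveClass.mk (Curve.const 0), fun h' => absurd h' h⟩
  choose sel hsel using hsel
  refine (measure_mono ?_).trans (hLB D.carrier δ (a δ) (b δ) q ρ θ hθ
    (fun L => ∃ p' ∈ t, CurveClass.mk (⟨polyline (L.map (meshPoint δ))⟩ : Curve ℂ) ∈ ball p' (ζr p'))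
    (fun L => farPast (πr (sel L)) q R') (fun L => εr (sel L)) ?_)
  · -- the inclusion of events
    intro γ hγ
    obtain ⟨k, hklen, hk, hkmin, hprefix, htrunc, j, hkj, hjlen, x, hx, hdist⟩ :=
      latticeEvent_of_conf hδ γ hρ₀ hγ
    have hGood : ∃ p' ∈ t, CurveClass.mk (⟨polyline (((γ.walk.support.take (k + 1))).map
        (meshPoint δ))⟩ : Curve ℂ) ∈ ball p' (ζr p') := by
      obtain ⟨p, hp, hmem⟩ := mem_iUnion₂.1 htrunc
      exact ⟨p, hp, hprefix ▸ hmem⟩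
    obtain ⟨hpt, hpball⟩ := hsel _ hGood
    refine ⟨k, hklen, hk, hkmin, hGood, j, hkj, hjlen, ?_⟩
    have hdist' : dist (CurveClass.mk (truncate (latticeCurve γ) (vertexTime k)))
        (CurveClass.mk (πr (sel (γ.walk.support.take (k + 1))))) <
          ζr (sel (γ.walk.support.take (k + 1))) := by
      rw [hπ _ hpt, ← hprefix]
      exact mem_ball.1 hpball
    obtain ⟨z, hz, hxz⟩ :=
      mem_thickening_iff.1 (farPast_subset_thickening_of_dist_lt hdist' q (hζR _ hpt) hx)
    refine ⟨z, hz, ?_⟩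
    have h₁ := dist_triangle (meshPoint δ (γ.walk.getVert j)) x z
    have h₂ := hε' _ hpt
    change dist (meshPoint δ (γ.walk.getVert j)) z < εr (sel (γ.walk.support.take (k + 1)))
    linarith
  · -- the conditional bound for good first-entrance prefixes, through the selected element
    intro t₀ ω htip hout hGood
    obtain ⟨hpt, hpball⟩ := hsel _ hGood
    exact hbound _ hpt t₀ ω htip hout hpball

/-! ## The registered stub -/

/-- **stub 2 — THE SOFT TRANSFER** (registered stub `stub_transferCore` of crux
stmt-CriticalPhenomena-4982, line slit-continuous-restriction): the four landed helper statements,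
sequential slit avoidance and the hull-avoidance values of subsequential limits give off-target
far-return nullity under every subsequential weak limit of the critical SAW laws. See the module
docstring for the seven steps. [folklore] -/
theorem stub_transferCore : LatticeBound → PrefixTiming → PastsCompact → SubArc →
    SequentialSlitAvoidance → AvoidanceValues → FarReturnNullOffTarget := by
  intro hLB _hPT hPC hSA hSeq hAV D a b s ν hab hL q r η hr hη
  obtain ⟨hs, hν, hw⟩ := hL
  haveI := hν
  have hU := locallyUniform_of_sequential hSeq
  -- (2) the measurable full-measure set of good classes
  have hfree := ae_source_target_range_of_weakLimitAlong (ν := ν) hab hs hw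
  have hshape := rangeArc_of_avoidanceValues hAV D a b hab s ν hs hν hw
  have hgood : ∀ᵐ c ∂ν, (c.source = D.pt 0 ∧ c.target = D.pt 1 ∧ c.range ⊆ closure D.carrier) ∧
      (∃ e : C(I, ℂ), Injective e ∧ range e = c.range ∧ e 0 = D.pt 0 ∧ e 1 = D.pt 1) ∧
      c.range ∩ frontier D.carrier ⊆ {D.pt 0, D.pt 1} := by
    filter_upwards [hfree, hshape] with c h₁ h₂
    exact ⟨h₁, h₂.1, h₂.2⟩
  obtain ⟨Z, hZsub, hZmeas, hZnull⟩ := exists_measurable_superset_of_null (ae_iff.1 hgood)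
  have hMgood : ∀ c ∈ Zᶜ, (c.source = D.pt 0 ∧ c.target = D.pt 1 ∧ c.range ⊆ closure D.carrier) ∧
      (∃ e : C(I, ℂ), Injective e ∧ range e = c.range ∧ e 0 = D.pt 0 ∧ e 1 = D.pt 1) ∧
      c.range ∩ frontier D.carrier ⊆ {D.pt 0, D.pt 1} := fun c hc =>
    Classical.byContradiction fun h => hc (hZsub h)
  have hMmeas : MeasurableSet Zᶜ := hZmeas.compl
  -- the source of a class in the event is `5r`-far from `q`
  have hsrc : ∀ c ∈ offTargetFarReturnEvent D q r η, c ∈ Zᶜ → 5 * r < dist (D.pt 0) q := by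
    rintro c ⟨γ, hγc, v, T, t', -, -, -, -, hguard, -, -⟩ hc
    have h0 := hguard 0 bot_le
    have hsource : γ 0 = D.pt 0 := by
      have h := (hMgood c hc).1.1
      rwa [← hγc, CurveClass.source_mk] at h
    rwa [hsource] at h0
  -- it suffices to bound by every positive `α`
  suffices hmain : ∀ α : ℝ, 0 < α → ν (offTargetFarReturnEvent D q r η) ≤ ENNReal.ofReal α by
    refine le_antisymm (ENNReal.le_of_forall_pos_le_add fun α hα _ => ?_) zero_le
    rw [zero_add, ← ENNReal.ofReal_coe_nnreal]
    exact hmain α (NNReal.coe_pos.2 hα)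
  intro α hα
  by_cases hfar : 5 * r < dist (D.pt 0) q
  swap
  · -- degenerate centre: the event misses the good set
    calc ν (offTargetFarReturnEvent D q r η) ≤ ν Z := measure_mono fun c hc =>
          Classical.byContradiction fun hcZ => hfar (hsrc c hc hcZ)
      _ ≤ ENNReal.ofReal α := by rw [hZnull]; exact zero_le
  -- (3) radii and the compact core of the good set
  have hα2 : 0 < α / 2 := half_pos hα
  obtain ⟨ρ, hρdef⟩ : ∃ ρ : ℝ, ρ = 3 * r / 2 := ⟨_, rfl⟩
  obtain ⟨ρ₀, hρ₀def⟩ : ∃ ρ₀ : ℝ, ρ₀ = 5 * r / 4 := ⟨_, rfl⟩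
  obtain ⟨ρ₁, hρ₁def⟩ : ∃ ρ₁ : ℝ, ρ₁ = 9 * r / 8 := ⟨_, rfl⟩
  obtain ⟨R, hRdef⟩ : ∃ R : ℝ, R = 4 * r := ⟨_, rfl⟩
  obtain ⟨R', hR'def⟩ : ∃ R' : ℝ, R' = 3 * r := ⟨_, rfl⟩
  obtain ⟨K, hKM, hK, hνK⟩ := hMmeas.exists_isCompact_sdiff_lt (measure_ne_top ν _)
    (ENNReal.ofReal_pos.2 hα2).ne'
  -- (4) the compact set of admissible pasts and its cover
  obtain ⟨hPc, hPshrink⟩ := hPC K hK q (D.pt 1) ρ ρ₁ η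
  have hadm : ∀ p ∈ pastSet K q (D.pt 1) ρ ρ₁ η 0, ∃ π : Curve ℂ, CurveClass.mk π = p ∧
      IsAdmissiblePast D π q ρ := by
    rintro p ⟨γ, w, hγK, htip, -, hfarb, rfl⟩
    obtain ⟨⟨hsource, -, hrange⟩, harc, hfront⟩ := hMgood _ (hKM hγK)
    rw [CurveClass.source_mk] at hsource
    rw [CurveClass.range_mk] at hrange harc hfront
    refine ⟨truncate γ w, rfl, hSA D γ w q ρ harc hfront hsource hrange ?_ ?_ ?_⟩
    · rw [mem_closedBall]
      linarith
    · intro h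
      rw [h] at htip
      linarith
    · intro u hu h
      have h' := hfarb u hu
      rw [h, dist_self] at h'
      linarith
  have hρ : 0 < ρ := by rw [hρdef]; linarith
  have hρR' : ρ < R' := by rw [hρdef, hR'def]; linarith
  obtain ⟨t, πr, εr, ζr, δr, hspec, hcover⟩ :=
    exists_cover hU hab hρ hρR' hα2 (half_pos hr) hPc hadm
  have hNopen : IsOpen (⋃ p ∈ t, ball p (ζr p)) := isOpen_biUnion fun _ _ => isOpen_ball
  obtain ⟨κ, hκ, hκsub⟩ := hPshrink _ hNopen hcover
  obtain ⟨ε', hε', hε'le⟩ := exists_pos_forall_le t (fun p => εr p / 4)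
    fun p hp => by have := (hspec p hp).2.1; positivity
  obtain ⟨δ₁, hδ₁, hδ₁le⟩ := exists_pos_forall_le t δr fun p hp => (hspec p hp).2.2.2.2.2.1
  -- (6) the lattice bound, eventually along `δ → 0⁺`
  have hδ₂ : 0 < min (r / 4) (min ε' δ₁) := lt_min (by linarith) (lt_min hε' hδ₁)
  have hev : ∀ᶠ δ in 𝓝[>] (0 : ℝ), SAW.law D.carrier δ (a δ) (b δ)
      {γ | Conf q ρ ρ₀ R ε' (⋃ p ∈ t, ball p (ζr p)) (latticeCurve γ)} ≤ ENNReal.ofReal (α / 2) := by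
    filter_upwards [Ioo_mem_nhdsGT hδ₂] with δ hδ
    obtain ⟨hδ0, hδlt⟩ := hδ
    have hδr : δ < r / 4 := hδlt.trans_le (min_le_left _ _)
    have hδε : δ < ε' := hδlt.trans_le ((min_le_right _ _).trans (min_le_left _ _))
    have hδδ₁ : δ < δ₁ := hδlt.trans_le ((min_le_right _ _).trans (min_le_right _ _))
    refine law_conf_le (R' := R') hLB hα2.le hδ0 (by rw [hρ₀def, hρdef]; linarith) t πr εr ζr
      (fun p hp => (hspec p hp).1) (fun p hp => ?_) (fun p hp => ?_) fun p hp t₀ ω htip hout hmem => ?_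
    · have := (hspec p hp).2.2.2.2.1
      rw [hR'def, hRdef]
      linarith
    · have h₁ := (hspec p hp).2.2.2.1
      have h₂ := hε'le p hp
      linarith
    · exact (hspec p hp).2.2.2.2.2.2 δ hδ0 (hδδ₁.trans_le (hδ₁le p hp)) t₀ ω htip hout hmem
  -- (5) the event core lies in the open squeeze configuration
  have hsub : offTargetFarReturnEvent D q r η ∩ K ⊆
      CurveClass.mk '' {γ | Conf q ρ ρ₀ R ε' (⋃ p ∈ t, ball p (ζr p)) γ} := by
    rintro c ⟨⟨γ, hγc, v, T, t', -, hTt, hT, -, hguard, hret, hoff⟩, hcK⟩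
    refine ⟨γ, conf_of_return (ρ₁ := ρ₁) (κ := κ) hTt hT hguard hret (by rw [hρ₁def]; linarith)
      (by rw [hρ₁def, hρ₀def]; linarith) (by rw [hρ₀def, hρdef]; linarith) (by rw [hρdef]; linarith)
      (by rw [hRdef]; linarith) hε' hκ fun w' _ hwT hdw hfarq => ?_, hγc⟩
    refine hκsub ⟨γ, w', hγc ▸ hcK, hdw.le, hfarq, fun u hu => hoff u (hu.trans hwT), rfl⟩
  -- (7) assemble
  have hport := measure_image_mk_le_limsup_law hs hw
    (isOpen_setOf_conf q ρ ρ₀ R ε' (⋃ p ∈ t, ball p (ζr p)) hNopen)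
  have hcore : ν (offTargetFarReturnEvent D q r η ∩ K) ≤ ENNReal.ofReal (α / 2) :=
    (measure_mono hsub).trans (hport.trans (limsup_le_of_le (by isBoundedDefault) hev))
  have hsplit : offTargetFarReturnEvent D q r η ⊆
      (offTargetFarReturnEvent D q r η ∩ K ∪ (Zᶜ \ K)) ∪ Z := by
    intro c hc
    by_cases hcZ : c ∈ Z
    · exact Or.inr hcZ
    · by_cases hcK : c ∈ K
      · exact Or.inl (Or.inl ⟨hc, hcK⟩)
      · exact Or.inl (Or.inr ⟨hcZ, hcK⟩)
  calc ν (offTargetFarReturnEvent D q r η)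
      ≤ ν ((offTargetFarReturnEvent D q r η ∩ K ∪ (Zᶜ \ K)) ∪ Z) := measure_mono hsplit
    _ ≤ ν (offTargetFarReturnEvent D q r η ∩ K) + ν (Zᶜ \ K) + ν Z :=
        (measure_union_le _ _).trans (add_le_add (measure_union_le _ _) le_rfl)
    _ ≤ ENNReal.ofReal (α / 2) + ENNReal.ofReal (α / 2) + 0 :=
        add_le_add (add_le_add hcore hνK.le) (le_of_eq hZnull)
    _ = ENNReal.ofReal α := by
        rw [add_zero, ← ENNReal.ofReal_add hα2.le hα2.le, add_halves]

end Summit.CriticalPhenomena.SAWScalingLimit.Theorems.SimpleSubseqLimits.SlitRestriction.Transfer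

end
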